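import Summits.ResolutionOfSingularities.ResolutionOfSingularities.Theorems.FrobeniusLadderFInjectiveMacaulayficationFHalfRowOfProductCentre
import Summits.ResolutionOfSingularities.ResolutionOfSingularities.Theorems.FrobeniusLadderFInjectiveMacaulayficationP2d4CTauKBlowupFull
import HarnessLib

/-!
# ★★★ F(4)-pos POSITIVE ROW #1 — the τ-floor of P2d4C is cured: the F-half's conclusion for EVERY blowing up of `Spec 𝒪_{X,v}` along `τ·𝒪`, UNCONDITIONAL
# (crux `FInjectiveMacaulayfication` stmt-ResolutionOfSingularities-15315, chain w45a; res-L1-w45a-plan-1 R18.12–R18.18 «F4POS-2»; seat res-L1-w45a-stub-3 g9 (F4POS-2b plumbing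
# p618085) over res-L1-w45a-stub-2 g8's F4POS-2a′ certificate row `P2d4CTauKBlowupFull.hrow_P2d4C` (τ·K product certificate ada44c2874c63a18 of res-L1-w45a-idea-1 / desk
# baded671c2236547))

[OURS · L1 W4.5a] Support file (`--supports stmt-ResolutionOfSingularities-15315 --as helper`); replaces the role of NO printed item; NOT a statement of any manuscript;
def-free; UNCONDITIONAL (certificate instance). AI-written (AI review is weaker than expert review).

THE ROW. `X = Spec (k[X0..X4]/(f))`, `f = X4² + X0⁴X4 + X1³ + X2³ + X3³`, `char k = 2` (ANY field), `v` = the vertex, `τ = (x̄0², x̄1, x̄2, x̄3, x̄4)` (the test-ideal centre of res-L1-w45a-plan-1's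
TAU-PROBE). For EVERY scheme `S′` and EVERY blowing up `g : S′ → Spec 𝒪_{X,v}` along `τ·𝒪_{X,v}` — the τ-FLOOR, an admissible Cohen–Macaulay local blow-up regular off its closed
fibre whose NON-FULL LOCUS IS 3-DIMENSIONAL (res-L1-w45a-stub-2 p615290, res-L1-w45a-stub-1 F4POS-1 (c)/(d): the first legal F(4)-pos INPUT of the F-half) — there is an ideal sheaf
`𝓚 ≠ ⊥` on `S′`, supported over the closed point, ALL of whose blowings up are FULL (locally integral ∧ Cohen–Macaulay ∧ parameter ideals Frobenius-closed) at EVERY stalk: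
LITERALLY the conclusion of the F-half `LocalFInjectivizationFibreAdmGe4` at `(d, p, X, x, S′, g, I) = (4, 2, P2d4C, v, S′, g, τ·𝒪)`. Proof = `FHalfRowOfProductCentre.tauFloor_P2d4C_cure`
(Stacks 080A composition + flat pull-back + blow-up uniqueness; `𝓚 := (K·𝒪_{X,v})·𝒪_{S′}`) fed with res-L1-w45a-stub-2's `span_KA_ne_bot`, `span_range_X_le_radical_span_KA` and
★ `hrow_P2d4C` (the affine blowing up of `X` along `τ·K` — `K` = the 22-monomial factor of the clean fan, 13 unimodular charts — is FULL at every point).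
CENSUS NOTE (res-L1-w45a-tri-2): the output is formally an iso-currency fact about `X` at `v` (centre `τK`); the row is F(4)-pos because of the INPUT legality of `S′ = Bl_τ X`.
[OURS · certificate instance; cite: StacksProject, Tag 080A; Fedder1983, Thm. 1.12 (the chart certificates)] [cite: GortzWedhorn2020, Prop. 13.92]
-/

-- single-problem summit: the doubled namespace component is forced
set_option linter.dupNamespace false

noncomputable section

namespace Summit.ResolutionOfSingularities.ResolutionOfSingularities.Theorems.FInjectiveMacaulayfication.TauFloorP2d4CRow

open CategoryTheory AlgebraicGeometry TopologicalSpace IsLocalRing MvPolynomial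
open Literature.AlgebraicGeometry.Resolution
open Summit.ResolutionOfSingularities.ResolutionOfSingularities.Theorems.FInjectiveMacaulayfication
open SliceableCentre

/-- ★★★ **F(4)-pos POSITIVE ROW #1 (unconditional)**: at the vertex `v` of P2d4C (`char k = 2`, any field `k`), for EVERY blowing up `g : S′ → Spec 𝒪_{X,v}` along `τ·𝒪_{X,v}`,
`τ = (x̄0², x̄1, x̄2, x̄3, x̄4)`, there is `𝓚 ≠ ⊥` on `S′` supported over the closed point all of whose blowings up are FULL at every stalk — the F-half's conclusion for the τ-floor.
[OURS · certificate instance; cite: StacksProject, Tag 080A; Fedder1983, Thm. 1.12] -/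
theorem tauFloor_P2d4C_row (k : Type) [Field k] [CharP k 2] (f : MvPolynomial (Fin 5) k)
    (hf : f = X 4 ^ 2 + X 0 ^ 4 * X 4 + X 1 ^ 3 + X 2 ^ 3 + X 3 ^ 3)
    (v : Spec (.of (MvPolynomial (Fin 5) k ⧸ Ideal.span {f})))
    (hv : v.asIdeal = Ideal.span (Set.range fun j : Fin 5 => Ideal.Quotient.mk (Ideal.span {f}) (X j))) :
    ∀ (S' : Scheme.{0}) (g : S' ⟶ Spec ((Spec (.of (MvPolynomial (Fin 5) k ⧸ Ideal.span {f}))).presheaf.stalk v)),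
      IsBlowup g ((affineBlowup.idealSheaf
        (Ideal.span {Ideal.Quotient.mk (Ideal.span {f}) (X 0) ^ 2, Ideal.Quotient.mk (Ideal.span {f}) (X 1),
          Ideal.Quotient.mk (Ideal.span {f}) (X 2), Ideal.Quotient.mk (Ideal.span {f}) (X 3), Ideal.Quotient.mk (Ideal.span {f}) (X 4)})).comap
        ((Spec (.of (MvPolynomial (Fin 5) k ⧸ Ideal.span {f}))).fromSpecStalk v)) →
      ∃ 𝓚 : S'.IdealSheafData, 𝓚 ≠ ⊥ ∧
        (∀ s ∈ (𝓚.support : Set S'), g.base s = closedPoint ((Spec (.of (MvPolynomial (Fin 5) k ⧸ Ideal.span {f}))).presheaf.stalk v)) ∧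
        ∀ (S'' : Scheme.{0}) (π : S'' ⟶ S'), IsBlowup π 𝓚 → ∀ s : S'', FullCl 2 (S''.presheaf.stalk s) :=
  FHalfRowOfProductCentre.tauFloor_P2d4C_cure k f hf v hv _ (P2d4CTauKBlowupFull.span_KA_ne_bot k f hf)
    (P2d4CTauKBlowupFull.span_range_X_le_radical_span_KA k f) (P2d4CTauKBlowupFull.hrow_P2d4C k f hf)

end Summit.ResolutionOfSingularities.ResolutionOfSingularities.Theorems.FInjectiveMacaulayfication.TauFloorP2d4CRow

end
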